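import Literature.Computability.AlgebraicComplexity.SLOrbitQuotientSetup
import Literature.Computability.AlgebraicComplexity.MS08StableAdmissibility
import Literature.RepresentationTheory.ClassicalInvariants.HilbertFinitenessTheorem
import HarnessLib

/-!
# The orbit map of a closed `SL`-orbit of forms is a quotient — II: the Reynolds operator of the
# stabiliser; `ℂ[SL]^H` is finitely generated and its maximal ideals are the cosets `gH`

Topic `Literature/Computability/AlgebraicComplexity`. Second file of the discharge programme for
`Grosshans1997_thm_1_11_slOrbit_forms` (Borel, LAG, Prop. 6.7 = Grosshans 1997, Thm. 1.11; cf.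
`SLOrbitQuotientSetup.lean`). For a form `w` whose `SL`-stabiliser `H = SL_σ(ℂ) ∩ G_w` is closed
under `h ↦ hᴴ` (which the Kempf–Ness theorem of `KempfNessSelfAdjointStabilizer.lean` arranges for
every polystable form after a translation), `H` is a self-adjoint algebraic subgroup of `GL_σ(ℂ)`,
hence REDUCTIVE (Matsushima; the tree's unitarian trick
`AlgebraicGroups.isSemisimpleRepresentation_of_star_mem`), and right translation by `H` on the
polynomial ring `ℂ[x_{ij}]` is the completely reducible substitution representation `stabRep w`
(through the Kronecker embedding `h ↦ 1 ⊗ h`). Consequences proved here: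

* § 1 plumbing: `kronRight h = 1 ⊗ₖ h`, `kronRightGL`, `stabRep w`; `eval_linSubst_kronRight`
  (substitution by `1 ⊗ h` is right translation `f ↦ f(· h)`); `kerSubrep w` (the polynomials
  vanishing on `SL` form a subrepresentation).
* § 2 `exists_invariant_lift`: every function of `ℂ[SL]^H` is the restriction of an `H`-INVARIANT
  polynomial (a stable complement of `kerSubrep`); hence **`rightInvariants_fg`**: `ℂ[SL]^H` is a
  finitely generated algebra (Hilbert's finiteness theorem of the tree,
  `HilbertFinitenessTheorem.exists_subalgebra_fg_of_star_mem`). [cite: Grosshans1997, Thm. 1.12 and §1]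
* § 3 `exists_ker_charAt_coordFns_eq` (weak Nullstellensatz on `SL`: maximal ideals of `ℂ[SL]` are
  points) and, via the Reynolds operator (`reynolds_mem_ker`: it preserves the ideal of `SL`; the
  Reynolds identity `E(b c) = b E(c)`), **`exists_ker_charAt_rightInvariants_eq`**: every maximal
  ideal of `ℂ[SL]^H` is the kernel of evaluation at some `g ∈ SL` — the points of `Spec ℂ[SL]^H`
  are the cosets `gH` (surjectivity of `G → G/\!/H`). [cite: MumfordFogartyKirwan1994, Ch. 1 §2 (Thm. 1.1: the quotient by a reductive group is surjective, invariants separate)]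

No named fact, no instance, no notation; definitions are plumbing with bodies. Honest framing:
textbook invariant theory; nothing here bears on VP versus VNP.

## References

* [Grosshans1997] F. D. Grosshans, *Algebraic Homogeneous Spaces and Invariant Theory*, LNM 1673
  (1997), §1, Thm. 1.11, Thm. 1.12.
* [MumfordFogartyKirwan1994] D. Mumford, J. Fogarty, F. Kirwan, *Geometric Invariant Theory*,
  3rd ed. (1994), Ch. 1 §1 (Reynolds operator), §2 Thm. 1.1.
* [GoodmanWallachGTM255] R. Goodman, N. R. Wallach, *Symmetry, Representations, and Invariants*
  (2009), Thm. 3.3.15, Thm. 5.1.1.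

## Provenance

Cell `val-lit`, seat `val-lit-t02` generation 7 (programme #7, bricks G1/G2).
-/

noncomputable section

open MvPolynomial
open scoped Matrix Kronecker

namespace Literature.Computability.AlgebraicComplexity

namespace SLOrbitQuotient

open Literature.NumberTheory.Automorphic (GLCoord glCoordFun IsAlgebraicSubgroup zeroLocusGL)
open Literature.RepresentationTheory.AlgebraicGroups (isAlgebraicSubgroup_of_mem_iff_det_eq_one
  det_star_eq_one)
open Literature.RepresentationTheory.ClassicalInvariants.PolynomialRingCompletelyReducible
  (isSemisimpleRepresentation_linSubstRep_comp)
open Literature.RepresentationTheory.ClassicalInvariants.HilbertFinitenessTheorem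
  (exists_subalgebra_fg_of_star_mem reynoldsOperator_mul_left)
open Literature.Geometry.Kaehler.Reynolds (reynoldsOperator reynoldsOperator_apply_mem
  reynoldsOperator_eq_self_iff comp_reynoldsOperator_eq_reynoldsOperator_comp)

variable {σ : Type} [Fintype σ] [DecidableEq σ]

/-! ### § 1 Right translation as a substitution representation of the stabiliser -/

/-- The Kronecker matrix `1 ⊗ h` of right multiplication `x ↦ x h` on `σ × σ` matrices.
[cite: GoodmanWallachGTM255, §5.1.1 (the substitution action on `𝒫(M_{n,k})`)] -/
def kronRight (h : Matrix σ σ ℂ) : Matrix (σ × σ) (σ × σ) ℂ :=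
  (1 : Matrix σ σ ℂ) ⊗ₖ h

omit [Fintype σ] in
/-- Entries of `1 ⊗ h`. [cite: GoodmanWallachGTM255, §5.1.1] -/
theorem kronRight_apply (h : Matrix σ σ ℂ) (a b : σ × σ) :
    kronRight h a b = if a.1 = b.1 then h a.2 b.2 else 0 := by
  rcases a with ⟨i, k⟩
  rcases b with ⟨i', j⟩
  rw [kronRight, Matrix.kronecker_apply, Matrix.one_apply]
  split_ifs <;> simp

omit [Fintype σ] in
/-- `1 ⊗ 1 = 1`. [cite: GoodmanWallachGTM255, §5.1.1] -/
theorem kronRight_one : kronRight (1 : Matrix σ σ ℂ) = 1 :=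
  Matrix.one_kronecker_one

/-- `1 ⊗ (g h) = (1 ⊗ g)(1 ⊗ h)`. [cite: GoodmanWallachGTM255, §5.1.1] -/
theorem kronRight_mul (g h : Matrix σ σ ℂ) : kronRight (g * h) = kronRight g * kronRight h := by
  rw [kronRight, kronRight, kronRight, ← Matrix.mul_kronecker_mul, Matrix.mul_one]

/-- `h ↦ 1 ⊗ h` as a monoid homomorphism of matrices. [cite: GoodmanWallachGTM255, §5.1.1] -/
def kronRightHom : Matrix σ σ ℂ →* Matrix (σ × σ) (σ × σ) ℂ where
  toFun := kronRight
  map_one' := kronRight_one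
  map_mul' := kronRight_mul

/-- `h ↦ 1 ⊗ h` on invertible matrices. [cite: GoodmanWallachGTM255, §5.1.1] -/
def kronRightGL : GL σ ℂ →* GL (σ × σ) ℂ :=
  Units.map (kronRightHom (σ := σ))

/-- The matrix of `kronRightGL g` is `1 ⊗ g`. [cite: GoodmanWallachGTM255, §5.1.1] -/
@[simp]
theorem coe_kronRightGL (g : GL σ ℂ) :
    ((kronRightGL g : GL (σ × σ) ℂ) : Matrix (σ × σ) (σ × σ) ℂ) = kronRight (g : Matrix σ σ ℂ) :=
  rfl

/-- **Substitution by `1 ⊗ h` is right translation**: `(f ∘ (1 ⊗ h))(g) = f(g h)`.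
[cite: GoodmanWallachGTM255, §5.1.1] -/
theorem eval_linSubst_kronRight (g h : Matrix σ σ ℂ) (f : MvPolynomial (σ × σ) ℂ) :
    MvPolynomial.eval (fun ij : σ × σ => g ij.1 ij.2) (linSubst (σ × σ) ℂ (kronRight h) f) =
      MvPolynomial.eval (fun ij : σ × σ => (g * h) ij.1 ij.2) f := by
  suffices H : (MvPolynomial.eval (fun ij : σ × σ => g ij.1 ij.2)).comp
      (linSubst (σ × σ) ℂ (kronRight h)).toRingHom =
      MvPolynomial.eval (fun ij : σ × σ => (g * h) ij.1 ij.2) from congr($H f)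
  apply MvPolynomial.ringHom_ext
  · intro c
    rw [RingHom.comp_apply, AlgHom.toRingHom_eq_coe, AlgHom.coe_toRingHom, linSubst_C, eval_C, eval_C]
  · rintro ⟨i, j⟩
    rw [RingHom.comp_apply, AlgHom.toRingHom_eq_coe, AlgHom.coe_toRingHom, linSubst_X, eval_X,
      Matrix.mul_apply, map_sum]
    simp only [smul_eq_C_mul, map_mul, eval_C, eval_X, kronRight_apply]
    rw [Fintype.sum_prod_type, Finset.sum_comm]
    simp only [ite_mul, zero_mul, Finset.sum_ite_eq', Finset.mem_univ, if_true]
    exact Finset.sum_congr rfl fun k _ => mul_comm _ _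

/-- The entries of `1 ⊗ g` are polynomial (indeed linear) in the coordinates of `g`.
[cite: GoodmanWallachGTM255, §5.1.1] -/
theorem kronRightGL_entries_polynomial (M : Subgroup (GL σ ℂ)) :
    ∀ a b : σ × σ, ∃ P : MvPolynomial (GLCoord σ) ℂ, ∀ g : M,
      (((kronRightGL.comp M.subtype) g : GL (σ × σ) ℂ) : Matrix (σ × σ) (σ × σ) ℂ) a b =
        MvPolynomial.eval (glCoordFun (g : GL σ ℂ)) P := by
  intro a b
  refine ⟨if a.1 = b.1 then X (Sum.inl (a.2, b.2)) else 0, fun g => ?_⟩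
  rw [MonoidHom.comp_apply, Subgroup.coe_subtype, coe_kronRightGL, kronRight_apply]
  split_ifs
  · rw [eval_X, Literature.NumberTheory.Automorphic.glCoordFun_inl]
  · rw [map_zero]

/-- **The substitution representation `stabRep w` of the stabiliser `SL_σ(ℂ) ∩ G_w`** on
`ℂ[x_{ij}]`: right translation `f ↦ f(· h)` (substitution by `1 ⊗ h`).
[cite: GoodmanWallachGTM255, §5.1.1 with Thm. 3.3.15] -/
def stabRep (w : MvPolynomial σ ℂ) :
    Representation ℂ ↥(slSubgroup σ ℂ ⊓ linStabilizer w) (MvPolynomial (σ × σ) ℂ) :=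
  (linSubstRep (σ × σ) ℂ).comp (kronRightGL.comp (slSubgroup σ ℂ ⊓ linStabilizer w).subtype)

/-- `stabRep w h f = f ∘ (1 ⊗ h)`. [cite: GoodmanWallachGTM255, §5.1.1] -/
theorem stabRep_apply (w : MvPolynomial σ ℂ) (h : ↥(slSubgroup σ ℂ ⊓ linStabilizer w))
    (f : MvPolynomial (σ × σ) ℂ) :
    stabRep w h f = linSubst (σ × σ) ℂ (kronRight ((h : GL σ ℂ) : Matrix σ σ ℂ)) f :=
  rfl

/-- `stabRep` acts by ring homomorphisms. [cite: GoodmanWallachGTM255, §5.1.1] -/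
theorem stabRep_mul (w : MvPolynomial σ ℂ) (h : ↥(slSubgroup σ ℂ ⊓ linStabilizer w))
    (f f' : MvPolynomial (σ × σ) ℂ) : stabRep w h (f * f') = stabRep w h f * stabRep w h f' := by
  rw [stabRep_apply, stabRep_apply, stabRep_apply, map_mul]

/-- The `SL`-element underlying a member of `SL_σ(ℂ) ∩ G_w`. [cite: Grosshans1997, §1] -/
def toSL {w : MvPolynomial σ ℂ} (h : ↥(slSubgroup σ ℂ ⊓ linStabilizer w)) :
    Matrix.SpecialLinearGroup σ ℂ :=
  ⟨((h : GL σ ℂ) : Matrix σ σ ℂ), mem_slSubgroup_iff.mp (Subgroup.mem_inf.mp h.2).1⟩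

/-- The matrix of `toSL h`. [cite: Grosshans1997, §1] -/
@[simp]
theorem coe_toSL {w : MvPolynomial σ ℂ} (h : ↥(slSubgroup σ ℂ ⊓ linStabilizer w)) :
    ((toSL h : Matrix.SpecialLinearGroup σ ℂ) : Matrix σ σ ℂ) = ((h : GL σ ℂ) : Matrix σ σ ℂ) :=
  rfl

/-- `toSL h` stabilises `w`. [cite: Grosshans1997, §1] -/
theorem linSubst_toSL {w : MvPolynomial σ ℂ} (h : ↥(slSubgroup σ ℂ ⊓ linStabilizer w)) :
    linSubst σ ℂ ((toSL h : Matrix.SpecialLinearGroup σ ℂ) : Matrix σ σ ℂ) w = w := by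
  have := (Subgroup.mem_inf.mp h.2).2
  rw [mem_linStabilizer, linSubstRep_apply] at this
  exact this

/-- **Equivariance of restriction to `SL`**: `slEval (stabRep w h f) = (slEval f)(· h)`.
[cite: Grosshans1997, §1 (`k[G]^H`, right translations)] -/
theorem slEval_stabRep (w : MvPolynomial σ ℂ) (h : ↥(slSubgroup σ ℂ ⊓ linStabilizer w))
    (f : MvPolynomial (σ × σ) ℂ) (g : Matrix.SpecialLinearGroup σ ℂ) :
    slEval (stabRep w h f) g = slEval f (g * toSL h) := by
  rw [slEval_apply, slEval_apply, stabRep_apply, eval_linSubst_kronRight,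
    Matrix.SpecialLinearGroup.coe_mul, coe_toSL]

/-- An element of `SL_σ(ℂ)` stabilising `w` as a member of `SL_σ(ℂ) ∩ G_w ≤ GL_σ(ℂ)`.
[cite: Grosshans1997, §1] -/
theorem toGL_mem_stab {w : MvPolynomial σ ℂ} (h : Matrix.SpecialLinearGroup σ ℂ)
    (hh : linSubst σ ℂ (h : Matrix σ σ ℂ) w = w) :
    Matrix.SpecialLinearGroup.toGL h ∈ slSubgroup σ ℂ ⊓ linStabilizer w := by
  refine Subgroup.mem_inf.mpr ⟨⟨h, rfl⟩, ?_⟩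
  rw [mem_linStabilizer, linSubstRep_apply, Matrix.SpecialLinearGroup.coe_GL_coe_matrix]
  exact hh

/-- The stabiliser `SL_σ(ℂ) ∩ G_w` is an algebraic subgroup of `GL_σ(ℂ)` (cut out by `det = 1`
and the coefficients of `X·w − w`). [cite: GoodmanWallachGTM255, §1.4.3 (algebraic subgroups)] -/
theorem isAlgebraicSubgroup_stab (w : MvPolynomial σ ℂ) :
    IsAlgebraicSubgroup (slSubgroup σ ℂ ⊓ linStabilizer w) := by
  classical
  have h1 : IsAlgebraicSubgroup (slSubgroup σ ℂ) :=
    isAlgebraicSubgroup_of_mem_iff_det_eq_one fun _ => mem_slSubgroup_iff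
  have h2 : IsAlgebraicSubgroup (linStabilizer w) := by
    refine ⟨Set.range fun d : σ →₀ ℕ => rename Sum.inl (coeff d
      (linSubst σ (MvPolynomial (σ × σ) ℂ) (Matrix.mvPolynomialX σ σ ℂ)
        (map (C : ℂ →+* MvPolynomial (σ × σ) ℂ) w))) - C (coeff d w), ?_⟩
    ext g
    simp only [SetLike.mem_coe, mem_linStabilizer, linSubstRep_apply, zeroLocusGL, Set.mem_setOf_eq,
      Set.forall_mem_range, map_sub, eval_C, sub_eq_zero]
    rw [MvPolynomial.ext_iff]
    refine forall_congr' fun d => ?_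
    rw [eval_rename]
    have : (glCoordFun g ∘ Sum.inl) = fun ij : σ × σ => (g : Matrix σ σ ℂ) ij.1 ij.2 := by
      funext ij; rfl
    rw [this, eval_coeff_genericLinSubst]
  exact h1.inf h2

/-- If the `SL`-stabiliser of `w` is closed under conjugate transpose, then `SL_σ(ℂ) ∩ G_w` is a
self-adjoint subgroup of `GL_σ(ℂ)`. [cite: GoodmanWallachGTM255, Thm. 3.3.15 (self-adjoint groups)] -/
theorem star_mem_stab {w : MvPolynomial σ ℂ}
    (hw : ∀ h : Matrix σ σ ℂ, h.det = 1 → linSubst σ ℂ h w = w → linSubst σ ℂ hᴴ w = w)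
    {g : GL σ ℂ} (hg : g ∈ slSubgroup σ ℂ ⊓ linStabilizer w) :
    star g ∈ slSubgroup σ ℂ ⊓ linStabilizer w := by
  obtain ⟨hsl, hst⟩ := Subgroup.mem_inf.mp hg
  rw [mem_slSubgroup_iff] at hsl
  rw [mem_linStabilizer, linSubstRep_apply] at hst
  refine Subgroup.mem_inf.mpr ⟨?_, ?_⟩
  · rw [mem_slSubgroup_iff]; exact det_star_eq_one hsl
  · rw [mem_linStabilizer, linSubstRep_apply, Units.coe_star, Matrix.star_eq_conjTranspose]
    exact hw _ hsl hst

/-- **Matsushima / the unitarian trick**: for a self-adjoint stabiliser, right translation on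
`ℂ[x_{ij}]` is completely reducible. [cite: GoodmanWallachGTM255, Thm. 3.3.15 with §4.2.1 (iii)] -/
theorem isSemisimpleRepresentation_stabRep {w : MvPolynomial σ ℂ}
    (hw : ∀ h : Matrix σ σ ℂ, h.det = 1 → linSubst σ ℂ h w = w → linSubst σ ℂ hᴴ w = w) :
    (stabRep w).IsSemisimpleRepresentation :=
  isSemisimpleRepresentation_linSubstRep_comp (isAlgebraicSubgroup_stab w)
    (fun _ hg => star_mem_stab hw hg) _ (kronRightGL_entries_polynomial _)

/-- The polynomials vanishing on `SL_σ(ℂ)` form a subrepresentation of `stabRep w` (the ideal of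
`SL` is stable under right translation). [cite: Grosshans1997, §1] -/
def kerSubrep (w : MvPolynomial σ ℂ) : Subrepresentation (stabRep w) where
  toSubmodule := LinearMap.ker (slEval (σ := σ)).toLinearMap
  apply_mem_toSubmodule := fun h f hf => by
    rw [LinearMap.mem_ker, AlgHom.toLinearMap_apply] at hf ⊢
    funext g
    rw [slEval_stabRep, hf, Pi.zero_apply, Pi.zero_apply]

/-- Membership in `kerSubrep`. [cite: Grosshans1997, §1] -/
theorem mem_kerSubrep_iff (w : MvPolynomial σ ℂ) (f : MvPolynomial (σ × σ) ℂ) :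
    f ∈ (kerSubrep w).toSubmodule ↔ slEval f = 0 :=
  LinearMap.mem_ker

/-! ### § 2 Invariant representatives; `ℂ[SL]^H` is finitely generated -/

/-- `IsCompl` of subrepresentations gives `IsCompl` of the underlying submodules. [folklore] -/
private theorem isCompl_toSubmodule_of_isCompl {G V : Type*} [Group G] [AddCommGroup V] [Module ℂ V]
    {τ : Representation ℂ G V} {T T' : Subrepresentation τ} (h : IsCompl T T') :
    IsCompl T.toSubmodule T'.toSubmodule := by
  rw [isCompl_iff, disjoint_iff, codisjoint_iff] at h ⊢
  exact ⟨by rw [← Subrepresentation.toSubmodule_inf, h.1]; rfl,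
    by rw [← Subrepresentation.toSubmodule_sup, h.2]; rfl⟩

/-- Restrictions of `H`-invariant polynomials lie in `ℂ[SL]^H`. [cite: Grosshans1997, §1] -/
theorem slEval_mem_rightInvariants_of_mem_invariants {w : MvPolynomial σ ℂ}
    {f : MvPolynomial (σ × σ) ℂ} (hf : f ∈ (stabRep w).invariants) :
    slEval f ∈ rightInvariants w := by
  refine ⟨slEval_mem_coordFns f, fun g h hh => ?_⟩
  have hmem := toGL_mem_stab h hh
  have := (Representation.mem_invariants _ _).mp hf ⟨_, hmem⟩
  have key := slEval_stabRep w ⟨_, hmem⟩ f g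
  rw [this] at key
  rw [key]
  rfl

/-- **Invariant representatives.** If the stabiliser is self-adjoint, every function of `ℂ[SL]^H`
is the restriction to `SL` of an `H`-INVARIANT polynomial: project a representative onto a stable
complement of the ideal of `SL`. [cite: Grosshans1997, Thm. 1.12 (with §1)] -/
theorem exists_invariant_lift {w : MvPolynomial σ ℂ}
    (hw : ∀ h : Matrix σ σ ℂ, h.det = 1 → linSubst σ ℂ h w = w → linSubst σ ℂ hᴴ w = w)
    {φ : Matrix.SpecialLinearGroup σ ℂ → ℂ} (hφ : φ ∈ rightInvariants w) :
    ∃ f : MvPolynomial (σ × σ) ℂ, f ∈ (stabRep w).invariants ∧ slEval f = φ := by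
  obtain ⟨f₀, hf₀⟩ := mem_coordFns_iff.mp hφ.1
  obtain ⟨Ic, hIc⟩ := (isSemisimpleRepresentation_stabRep hw).exists_isCompl (kerSubrep w)
  have hIc' := isCompl_toSubmodule_of_isCompl hIc
  obtain ⟨i, hi, c, hc, hsum⟩ := Submodule.mem_sup.mp
    (show f₀ ∈ (kerSubrep w).toSubmodule ⊔ Ic.toSubmodule by rw [hIc'.sup_eq_top]; trivial)
  have hi0 : slEval i = 0 := (mem_kerSubrep_iff w i).mp hi
  have hcφ : slEval c = φ := by
    rw [← hf₀, ← hsum, map_add, hi0, zero_add]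
  refine ⟨c, (Representation.mem_invariants _ _).mpr fun h => ?_, hcφ⟩
  -- `ρ h c − c ∈ I ∩ Ic = 0`
  have hmemc : stabRep w h c - c ∈ Ic.toSubmodule :=
    sub_mem (Ic.apply_mem_toSubmodule h hc) hc
  have hmemI : stabRep w h c - c ∈ (kerSubrep w).toSubmodule := by
    rw [mem_kerSubrep_iff, map_sub, sub_eq_zero]
    funext g
    rw [slEval_stabRep, hcφ]
    exact hφ.2 g (toSL h) (linSubst_toSL h)
  have : stabRep w h c - c = 0 := by
    have hbot := hIc'.inf_eq_bot
    have hmem : stabRep w h c - c ∈ (kerSubrep w).toSubmodule ⊓ Ic.toSubmodule := ⟨hmemI, hmemc⟩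
    rw [hbot] at hmem
    exact (Submodule.mem_bot ℂ).mp hmem
  exact sub_eq_zero.mp this

/-- **`ℂ[SL]^H` is the image of the invariant ring `ℂ[x_{ij}]^H`.**
[cite: Grosshans1997, Thm. 1.12 (with §1)] -/
theorem rightInvariants_eq_map {w : MvPolynomial σ ℂ}
    (hw : ∀ h : Matrix σ σ ℂ, h.det = 1 → linSubst σ ℂ h w = w → linSubst σ ℂ hᴴ w = w)
    {J : Subalgebra ℂ (MvPolynomial (σ × σ) ℂ)}
    (hJ : (J : Set (MvPolynomial (σ × σ) ℂ)) = (stabRep w).invariants) :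
    rightInvariants w = J.map slEval := by
  apply le_antisymm
  · intro φ hφ
    obtain ⟨f, hf, rfl⟩ := exists_invariant_lift hw hφ
    refine ⟨f, ?_, rfl⟩
    have h := Set.ext_iff.mp hJ f
    simp only [SetLike.mem_coe] at h
    exact h.mpr hf
  · rintro _ ⟨f, hf, rfl⟩
    have h := Set.ext_iff.mp hJ f
    simp only [SetLike.mem_coe] at h
    exact slEval_mem_rightInvariants_of_mem_invariants (h.mp hf)

/-- **`ℂ[SL]^H` is a finitely generated algebra** (Hilbert's finiteness theorem for the reductive
group `H`, tree `HilbertFinitenessTheorem.exists_subalgebra_fg_of_star_mem`, pushed to `SL`).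
[cite: Grosshans1997, Thm. 1.12; GoodmanWallachGTM255, Thm. 5.1.1] -/
theorem rightInvariants_fg {w : MvPolynomial σ ℂ}
    (hw : ∀ h : Matrix σ σ ℂ, h.det = 1 → linSubst σ ℂ h w = w → linSubst σ ℂ hᴴ w = w) :
    (rightInvariants w).FG := by
  obtain ⟨J, hJ, hJfg⟩ := exists_subalgebra_fg_of_star_mem (isAlgebraicSubgroup_stab w)
    (fun _ hg => star_mem_stab hw hg) (kronRightGL.comp (slSubgroup σ ℂ ⊓ linStabilizer w).subtype)
    (kronRightGL_entries_polynomial _)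
  rw [rightInvariants_eq_map hw hJ]
  exact hJfg.map _

/-- Hence `ℂ[SL]^H` is of finite type over `ℂ`. [cite: Grosshans1997, Thm. 1.12] -/
theorem finiteType_rightInvariants {w : MvPolynomial σ ℂ}
    (hw : ∀ h : Matrix σ σ ℂ, h.det = 1 → linSubst σ ℂ h w = w → linSubst σ ℂ hᴴ w = w) :
    Algebra.FiniteType ℂ (rightInvariants w) :=
  (Subalgebra.fg_iff_finiteType _).mp (rightInvariants_fg hw)

/-! ### § 3 Maximal ideals: points of `SL` and cosets `gH` -/

/-- **Weak Nullstellensatz on `SL_σ(ℂ)`**: every maximal ideal of `ℂ[SL]` is the kernel of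
evaluation at a point of `SL_σ(ℂ)`. [cite: SpringerLAG1998, 1.3.1 with 2.1.4] -/
theorem exists_ker_charAt_coordFns_eq (𝔪 : Ideal (coordFns σ)) (h𝔪 : 𝔪.IsMaximal) :
    ∃ g : Matrix.SpecialLinearGroup σ ℂ, 𝔪 = RingHom.ker (charAt (coordFns σ) g) := by
  set π : MvPolynomial (σ × σ) ℂ →ₐ[ℂ] coordFns σ := (slEval (σ := σ)).rangeRestrict with hπ
  have hπsurj : Function.Surjective π := AlgHom.rangeRestrict_surjective _
  have hπval : ∀ f, ((π f : coordFns σ) : Matrix.SpecialLinearGroup σ ℂ → ℂ) = slEval f := fun f => rfl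
  haveI : (𝔪.comap π).IsMaximal := Ideal.comap_isMaximal_of_surjective _ hπsurj
  obtain ⟨x, hx⟩ := (MvPolynomial.isMaximal_iff_eq_vanishingIdeal_singleton (I := 𝔪.comap π)).mp
    inferInstance
  -- `det x = 1`: the polynomial `det X − 1` restricts to `0` on `SL`
  set D : MvPolynomial (σ × σ) ℂ := (Matrix.mvPolynomialX σ σ ℂ).det - 1 with hD
  have hDker : slEval D = 0 := by
    funext g
    rw [slEval_apply, hD, map_sub, map_one, RingHom.map_det, Matrix.mvPolynomialX_mapMatrix_eval,
      g.2, sub_self, Pi.zero_apply]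
  have hDmem : D ∈ 𝔪.comap π := by
    rw [Ideal.mem_comap]
    have : π D = 0 := Subtype.ext (by rw [hπval, hDker]; rfl)
    rw [this]; exact 𝔪.zero_mem
  rw [hx, MvPolynomial.mem_vanishingIdeal_singleton_iff, aeval_eq_eval, hD, map_sub, map_one,
    sub_eq_zero, RingHom.map_det] at hDmem
  set g₀ : Matrix.SpecialLinearGroup σ ℂ := ⟨Matrix.of fun i j => x (i, j), by
    rw [← hDmem]; congr 1; ext i j; simp [Matrix.mvPolynomialX]⟩ with hg₀
  refine ⟨g₀, ?_⟩
  refine (h𝔪.eq_of_le (RingHom.ker_ne_top _) fun φ hφ => ?_)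
  obtain ⟨f, rfl⟩ := hπsurj φ
  have hf : f ∈ 𝔪.comap π := Ideal.mem_comap.mpr hφ
  rw [hx, MvPolynomial.mem_vanishingIdeal_singleton_iff, aeval_eq_eval] at hf
  rw [RingHom.mem_ker, charAt_apply, hπval, slEval_apply]
  have : (fun ij : σ × σ => (g₀ : Matrix σ σ ℂ) ij.1 ij.2) = x := by
    funext ij; rw [hg₀]; simp
  rw [this]
  exact hf

/-- The Reynolds operator of `stabRep w` preserves the ideal of `SL_σ(ℂ)` (naturality with respect
to the equivariant projection onto a stable complement). [cite: MumfordFogartyKirwan1994, Ch. 1 §1 (naturality of the Reynolds operator)] -/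
theorem reynolds_mem_ker {w : MvPolynomial σ ℂ}
    (hw : ∀ h : Matrix σ σ ℂ, h.det = 1 → linSubst σ ℂ h w = w → linSubst σ ℂ hᴴ w = w)
    {f : MvPolynomial (σ × σ) ℂ} (hf : slEval f = 0) :
    slEval (reynoldsOperator (stabRep w) (isSemisimpleRepresentation_stabRep hw) f) = 0 := by
  set hs := isSemisimpleRepresentation_stabRep hw
  obtain ⟨Ic, hIc⟩ := hs.exists_isCompl (kerSubrep w)
  have hIc' : IsCompl Ic.toSubmodule (kerSubrep w).toSubmodule := (isCompl_toSubmodule_of_isCompl hIc).symm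
  -- the projection onto `Ic` along the ideal of `SL`, an equivariant endomorphism
  obtain ⟨π, hπker, hπc⟩ : ∃ π : MvPolynomial (σ × σ) ℂ →ₗ[ℂ] MvPolynomial (σ × σ) ℂ,
      (∀ u, u ∈ (kerSubrep w).toSubmodule → π u = 0) ∧ (∀ u, u ∈ Ic.toSubmodule → π u = u) :=
    ⟨Ic.toSubmodule.projection (kerSubrep w).toSubmodule hIc',
      fun u hu => (Submodule.projection_apply_eq_zero_iff hIc').mpr hu,
      fun u hu => Submodule.projection_apply_of_mem_left hIc' hu⟩
  have hkerπ : ∀ u, π u = 0 → u ∈ (kerSubrep w).toSubmodule := by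
    intro u hu
    obtain ⟨c, hc, i, hi, rfl⟩ := Submodule.mem_sup.mp
      (show u ∈ Ic.toSubmodule ⊔ (kerSubrep w).toSubmodule by rw [hIc'.sup_eq_top]; trivial)
    rw [map_add, hπc c hc, hπker i hi, add_zero] at hu
    rw [hu, zero_add]; exact hi
  have hcomm : ∀ h, π ∘ₗ (stabRep w h) = (stabRep w h) ∘ₗ π := by
    intro h
    refine LinearMap.ext fun u => ?_
    obtain ⟨c, hc, i, hi, rfl⟩ := Submodule.mem_sup.mp
      (show u ∈ Ic.toSubmodule ⊔ (kerSubrep w).toSubmodule by rw [hIc'.sup_eq_top]; trivial)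
    rw [LinearMap.comp_apply, LinearMap.comp_apply, map_add, map_add, map_add,
      hπc c hc, hπker i hi, add_zero, hπc _ (Ic.apply_mem_toSubmodule h hc),
      hπker _ ((kerSubrep w).apply_mem_toSubmodule h hi), add_zero]
  have hnat := comp_reynoldsOperator_eq_reynoldsOperator_comp (stabRep w) (stabRep w) hs hs π hcomm
  have key := LinearMap.congr_fun hnat f
  rw [LinearMap.comp_apply, LinearMap.comp_apply, hπker f ((mem_kerSubrep_iff w f).mpr hf),
    map_zero] at key
  exact (mem_kerSubrep_iff w _).mp (hkerπ _ key)

/-- **Reynolds argument**: an ideal of `ℂ[SL]^H` which generates the unit ideal of `ℂ[SL]` is the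
unit ideal (`I·ℂ[SL] ∩ ℂ[SL]^H = I` for the reductive `H`). [cite: MumfordFogartyKirwan1994, Ch. 1 §2 (proof of Thm. 1.1: `(∑ fᵢ 𝒪_X)^G = ∑ fᵢ 𝒪_X^G` via the Reynolds operator)] -/
theorem ideal_eq_top_of_sum_eq_one {w : MvPolynomial σ ℂ}
    (hw : ∀ h : Matrix σ σ ℂ, h.det = 1 → linSubst σ ℂ h w = w → linSubst σ ℂ hᴴ w = w)
    (n : Ideal (rightInvariants w)) {ι : Type} (s : Finset ι) (β : ι → rightInvariants w)
    (γ : ι → (Matrix.SpecialLinearGroup σ ℂ → ℂ)) (hβ : ∀ i ∈ s, β i ∈ n)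
    (hγ : ∀ i ∈ s, γ i ∈ coordFns σ)
    (hsum : ∑ i ∈ s, (β i : Matrix.SpecialLinearGroup σ ℂ → ℂ) * γ i = 1) : n = ⊤ := by
  classical
  set hs := isSemisimpleRepresentation_stabRep hw
  set R := reynoldsOperator (stabRep w) hs with hR
  -- invariant lifts `b i` of `β i`, arbitrary lifts `c i` of `γ i`
  have hb : ∀ i ∈ s, ∃ b : MvPolynomial (σ × σ) ℂ, b ∈ (stabRep w).invariants ∧
      slEval b = (β i : Matrix.SpecialLinearGroup σ ℂ → ℂ) :=
    fun i _ => exists_invariant_lift hw (β i).2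
  choose! b hbinv hbval using hb
  have hc : ∀ i ∈ s, ∃ c : MvPolynomial (σ × σ) ℂ, slEval c = γ i :=
    fun i hi => mem_coordFns_iff.mp (hγ i hi)
  choose! c hcval using hc
  -- `u = 1 − ∑ bᵢ cᵢ` vanishes on `SL`; apply the Reynolds operator
  set u : MvPolynomial (σ × σ) ℂ := 1 - ∑ i ∈ s, b i * c i with hu
  have hu0 : slEval u = 0 := by
    rw [hu, map_sub, map_one, map_sum, sub_eq_zero, eq_comm]
    rw [← hsum]
    refine Finset.sum_congr rfl fun i hi => ?_
    rw [map_mul, hbval i hi, hcval i hi]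
  have hR1 : R 1 = 1 := by
    rw [hR, reynoldsOperator_eq_self_iff]
    refine (Representation.mem_invariants _ _).mpr fun h => ?_
    rw [stabRep_apply, map_one]
  have hRu : slEval (R u) = 0 := reynolds_mem_ker hw hu0
  have hRbc : ∀ i ∈ s, R (b i * c i) = b i * R (c i) :=
    fun i hi => reynoldsOperator_mul_left (stabRep w) (stabRep_mul w) hs (hbinv i hi) (c i)
  have hdecomp : (1 : MvPolynomial (σ × σ) ℂ) = ∑ i ∈ s, b i * R (c i) + R u := by
    have : R 1 = R (∑ i ∈ s, b i * c i) + R u := by rw [← map_add, hu, add_sub_cancel]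
    rw [hR1, map_sum] at this
    rw [this]
    congr 1
    exact Finset.sum_congr rfl fun i hi => hRbc i hi
  -- restrict to `SL`: `1 = ∑ βᵢ δᵢ` with `δᵢ ∈ ℂ[SL]^H`
  have hδ : ∀ i ∈ s, slEval (R (c i)) ∈ rightInvariants w := fun i _ =>
    slEval_mem_rightInvariants_of_mem_invariants (reynoldsOperator_apply_mem _ hs _)
  have hone : (1 : rightInvariants w) =
      ∑ i ∈ s.attach, β i * ⟨slEval (R (c i)), hδ i i.2⟩ := by
    apply Subtype.ext
    have h1 := congrArg slEval hdecomp
    rw [map_one, map_add, hRu, add_zero, map_sum] at h1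
    rw [Subalgebra.coe_one, h1, AddSubmonoidClass.coe_finsetSum, ← Finset.sum_attach s]
    refine Finset.sum_congr rfl fun i _ => ?_
    rw [Subalgebra.coe_mul, map_mul, hbval i i.2]
  rw [Ideal.eq_top_iff_one, hone]
  exact Ideal.sum_mem _ fun i _ => Ideal.mul_mem_right _ _ (hβ i i.2)

/-- **The maximal ideals of `ℂ[SL]^H` are the cosets `gH`**: every maximal ideal of `ℂ[SL]^H` is
the kernel of evaluation at some `g ∈ SL_σ(ℂ)` (surjectivity of `SL → Spec ℂ[SL]^H`: an ideal of
the invariants generating the unit ideal upstairs is the unit ideal — Reynolds — and the weak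
Nullstellensatz on `SL`). [cite: MumfordFogartyKirwan1994, Ch. 1 §2 Thm. 1.1 (surjectivity of the quotient map for a reductive group)] -/
theorem exists_ker_charAt_rightInvariants_eq {w : MvPolynomial σ ℂ}
    (hw : ∀ h : Matrix σ σ ℂ, h.det = 1 → linSubst σ ℂ h w = w → linSubst σ ℂ hᴴ w = w)
    (n : Ideal (rightInvariants w)) (hn : n.IsMaximal) :
    ∃ g : Matrix.SpecialLinearGroup σ ℂ, n = RingHom.ker (charAt (rightInvariants w) g) := by
  classical
  set incl : rightInvariants w →ₐ[ℂ] coordFns σ := Subalgebra.inclusion (rightInvariants_le_coordFns w)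
    with hincl
  set nC : Ideal (coordFns σ) := n.map incl with hnC
  have hnCtop : nC ≠ ⊤ := by
    intro htop
    have h1 : (1 : coordFns σ) ∈ nC := htop ▸ Submodule.mem_top
    rw [hnC, Ideal.map, Submodule.mem_span_set'] at h1
    obtain ⟨m, cf, xf, hx⟩ := h1
    have hxmem : ∀ i, ∃ βi : rightInvariants w, βi ∈ n ∧ incl βi = (xf i : coordFns σ) := by
      intro i
      obtain ⟨βi, hβi, hβieq⟩ := (xf i).2
      exact ⟨βi, hβi, hβieq⟩
    choose β hβn hβeq using hxmem
    have hsum : ∑ i ∈ (Finset.univ : Finset (Fin m)),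
        (β i : Matrix.SpecialLinearGroup σ ℂ → ℂ) * (cf i : Matrix.SpecialLinearGroup σ ℂ → ℂ) = 1 := by
      have := congrArg (fun z : coordFns σ => (z : Matrix.SpecialLinearGroup σ ℂ → ℂ)) hx
      simp only [Subalgebra.coe_one, AddSubmonoidClass.coe_finsetSum, smul_eq_mul,
        Subalgebra.coe_mul] at this
      rw [← this]
      refine Finset.sum_congr rfl fun i _ => ?_
      rw [mul_comm, ← hβeq i]
      rfl
    have := ideal_eq_top_of_sum_eq_one hw n Finset.univ β (fun i => (cf i : Matrix.SpecialLinearGroup σ ℂ → ℂ))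
      (fun i _ => hβn i) (fun i _ => (cf i).2) hsum
    exact hn.ne_top this
  obtain ⟨𝔪, h𝔪, hle⟩ := Ideal.exists_le_maximal nC hnCtop
  obtain ⟨g, hg⟩ := exists_ker_charAt_coordFns_eq 𝔪 h𝔪
  refine ⟨g, hn.eq_of_le (RingHom.ker_ne_top _) fun φ hφ => ?_⟩
  have : incl φ ∈ 𝔪 := hle (Ideal.mem_map_of_mem _ hφ)
  rw [hg, RingHom.mem_ker, charAt_apply] at this
  rw [RingHom.mem_ker, charAt_apply]
  exact this

end SLOrbitQuotient

end Literature.Computability.AlgebraicComplexity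

end
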